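import Summits.Schanuel.Schanuel.Theorems.RootDecomp1ETwoScale01

/-!
# RootDecomp1ETwoScale — lens 2, generation 37 «TWO-SCALE E-PLANES» (items 25020 / 31409 of route 1E at n = 4 on `InTwoScaleClass`, mod NW96 Thm 1) — continuation (RootDecomp1ETwoScale02): §2 the two scale classes `LogPowLiouville p`, `CoveredTower` and the members (`coveredTower_ptower_four`, `logPowLiouville_ptower`, order separation `not_liouvilleOrder_one_ptower`, `not_hyperLiouville_ptower`)

(lens-2 g37 `TwoScale.lean` v2 [HOME/decomp-schanuel-lens-2/g37/TwoScale.lean v2 sha256 e81e28b8…d084, 2853 l (v1 df3b5e32…, 2509 l + §5b); own farm rc 0 · 0 warn · 0 sorry · axioms std; critic VERDICT STATUS L1776 (credit E-R17, PORT GO), v2 ACK L1780]; port by census-1 gen 16 in nine parts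
`RootDecomp1ETwoScale01`–`09` — see the PORT NOTE of part 01; `--supports stmt-Schanuel-31409`; rung 0.)
-/

open Complex Polynomial IntermediateField Filter

namespace Summit.Schanuel.Schanuel.Theorems.RootDecomp1ETwoScale

open Summit.Schanuel.Schanuel.Theorems.RootDecomp1KHyper
open Summit.Schanuel.Schanuel.Theorems.RootDecomp1KHyper.HyperCell
open Summit.Schanuel.Schanuel.Theorems.RootDecomp1KGeneric
open Literature.NumberTheory.Transcendental (NesterenkoWaldschmidt1996_thm_1 weilHeight₁)

variable {K : ℕ}

/-! ## §2  The two scale classes and the members -/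

/-- **`LogPowLiouville p ρ`** («poly-log Liouville of exponent `p`»): for every `m` there are rationals of
arbitrarily large denominator `q` with `|ρ − r| < exp(−m (log q)^p)`.  `p = 2` is lens 6's TREE class
`LogSqLiouville` (by `Iff.rfl`, below); the classes decrease in `p`; every `HyperLiouville` real is in all of
them; NONE of them implies any exponential order (members below are NOT of exponential order `1`). -/
def LogPowLiouville (p : ℕ) (ρ : ℝ) : Prop :=
  ∀ m : ℕ, ∃ r : ℚ, m ≤ r.den ∧ ρ ≠ r ∧ |ρ - r| < Real.exp (-((m : ℝ) * Real.log r.den ^ p))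

/-- `LogPowLiouville 2` IS lens 6's tree class `LogSqLiouville`. -/
theorem logPowLiouville_two_iff (ρ : ℝ) : LogPowLiouville 2 ρ ↔ LogSqLiouville ρ := Iff.rfl

/-- Monotonicity in the exponent: `LogPowLiouville p ρ → LogPowLiouville p' ρ` for `1 ≤ p' ≤ p`
(denominators `≥ 3` have `log q ≥ 1`). -/
theorem LogPowLiouville.mono {p p' : ℕ} {ρ : ℝ} (h : LogPowLiouville p ρ) (hp' : p' ≤ p) :
    LogPowLiouville p' ρ := by
  intro m
  obtain ⟨r, hden, hne, hlt⟩ := h (m + 3)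
  refine ⟨r, by omega, hne, hlt.trans_le ?_⟩
  rw [Real.exp_le_exp, neg_le_neg_iff]
  have hq3 : (3 : ℝ) ≤ r.den := by exact_mod_cast (show 3 ≤ r.den by omega)
  have hlog1 : 1 ≤ Real.log r.den := by
    rw [Real.le_log_iff_exp_le (by linarith)]
    have := Real.exp_one_lt_d9; linarith
  have hpow : Real.log r.den ^ p' ≤ Real.log r.den ^ p := pow_le_pow_right₀ hlog1 hp'
  have hm : (m : ℝ) ≤ ((m + 3 : ℕ) : ℝ) := by push_cast; linarith
  exact mul_le_mul hm hpow (by positivity) (by positivity)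

/-- **`CoveredTower ρ`** — the ANCHOR class («covered log-cube tower»): beyond a threshold, EVERY scale `X`
carries a rational approximant whose denominator lies in the window `[X, exp(4 (log X)^4)]` and whose quality
is `exp(−(log q)^3)`.  A COVERING condition (every scale), not an infinitely-often one: this is what makes the
pair `(ρ, e^ρ)` MEASURABLE (§4) — the approximant can be taken at the scale dictated by the height of the
relation to be bounded, at a polylogarithmic price. -/
def CoveredTower (ρ : ℝ) : Prop :=
  ∃ N₀ : ℕ, ∀ X : ℕ, N₀ ≤ X → ∃ r : ℚ, X ≤ r.den ∧
    Real.log r.den ≤ 4 * Real.log X ^ 4 ∧ |ρ - r| ≤ Real.exp (-(Real.log r.den ^ 3))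

/-- `log 2` bounds used below. -/
private theorem log_two_bounds : 0.6931471803 < Real.log 2 ∧ Real.log 2 < 0.6931471808 :=
  ⟨Real.log_two_gt_d9, Real.log_two_lt_d9⟩

/-- `log (2^a) = a log 2` for the tower denominators. -/
private theorem log_two_pow_nat (a : ℕ) : Real.log (((2 ^ a : ℕ) : ℝ)) = a * Real.log 2 := by
  push_cast
  rw [Real.log_pow]

/-- The quality of the truncations in poly-log terms: `2·2^{−a^d} < exp(−m (a log 2)^p)` once `p + 1 ≤ d`,
`1 ≤ p` and `a ≥ m + 2`. -/
theorem trunc_quality {p d a m : ℕ} (hp : 1 ≤ p) (hpd : p + 1 ≤ d) (ha : m + 2 ≤ a) :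
    2 * (1 / (2 : ℝ) ^ (a ^ d)) < Real.exp (-((m : ℝ) * ((a : ℝ) * Real.log 2) ^ p)) := by
  obtain ⟨hl2, hl2'⟩ := log_two_bounds
  have hl20 : 0 < Real.log 2 := by linarith
  have hl21 : Real.log 2 ≤ 1 := by linarith
  -- `2 · 2^{−a^d} = exp(log 2 · (1 − a^d))`
  have e1 : 2 * (1 / (2 : ℝ) ^ (a ^ d)) = Real.exp (Real.log 2 * (1 - (a : ℝ) ^ d)) := by
    have : Real.log 2 * (1 - (a : ℝ) ^ d) = Real.log 2 - ((a ^ d : ℕ) : ℝ) * Real.log 2 := by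
      push_cast; ring
    rw [this, Real.exp_sub, Real.exp_nat_mul, Real.exp_log (by norm_num)]
    ring
  rw [e1, Real.exp_lt_exp]
  -- `(a log 2)^p ≤ a^p log 2` and `m a^p + 1 < a^d`
  have hpow : ((a : ℝ) * Real.log 2) ^ p ≤ (a : ℝ) ^ p * Real.log 2 := by
    rw [mul_pow]
    have : Real.log 2 ^ p ≤ Real.log 2 := by
      calc Real.log 2 ^ p ≤ Real.log 2 ^ 1 := pow_le_pow_of_le_one hl20.le hl21 hp
        _ = Real.log 2 := pow_one _
    exact mul_le_mul_of_nonneg_left this (by positivity)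
  have hkey : (m : ℝ) * (a : ℝ) ^ p + 1 < (a : ℝ) ^ d := by
    have h1 : (m + 2 : ℝ) * (a : ℝ) ^ p ≤ (a : ℝ) ^ d := by
      calc (m + 2 : ℝ) * (a : ℝ) ^ p ≤ (a : ℝ) * (a : ℝ) ^ p := by
            have : (m + 2 : ℝ) ≤ a := by exact_mod_cast ha
            exact mul_le_mul_of_nonneg_right this (by positivity)
        _ = (a : ℝ) ^ (p + 1) := by ring
        _ ≤ (a : ℝ) ^ d := pow_le_pow_right₀ (by exact_mod_cast (show 1 ≤ a by omega)) hpd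
    have h2 : (1 : ℝ) ≤ (a : ℝ) ^ p := one_le_pow₀ (by exact_mod_cast (show 1 ≤ a by omega))
    nlinarith
  have hm0 : (0 : ℝ) ≤ m := Nat.cast_nonneg m
  nlinarith [mul_le_mul_of_nonneg_left hpow hm0]

/-- **`P_d` is poly-log Liouville of every exponent `p ≤ d − 1`** (hypothesis-free): the truncation `s_K`,
`K = m + 1`, has denominator `Q_K = 2^{a_K} ≥ m` and error `≤ 2·2^{−a_K^d} < exp(−m (log Q_K)^p)`. -/
theorem logPowLiouville_ptower {p d : ℕ} (hp : 1 ≤ p) (hpd : p + 1 ≤ d) : LogPowLiouville p (ptower d) := by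
  have hd : 2 ≤ d := by omega
  intro m
  obtain ⟨r, hden, hlow, hup⟩ := ptower_truncation hd (m + 1)
  have ha : m + 2 ≤ pexp d (m + 1) := succ_le_pexp hd (m + 1)
  refine ⟨r, ?_, ?_, ?_⟩
  · rw [hden]
    exact le_trans (by omega) (le_trans ha Nat.lt_two_pow_self.le)
  · intro h
    have : ptower d - r = 0 := by rw [h, sub_self]
    have hpos : (0 : ℝ) < 1 / (2 : ℝ) ^ pexp d (m + 1 + 1) := by positivity
    linarith
  · have hpos : 0 < ptower d - r := lt_of_lt_of_le (by positivity) hlow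
    rw [abs_of_pos hpos, hden, log_two_pow_nat]
    refine lt_of_le_of_lt hup ?_
    rw [pexp_succ d (m + 1)]
    exact trunc_quality hp hpd ha

/-- **The anchor member: `P_4 = Σ_k 2^{−2^{4^k}}` is a covered log-cube tower** (hypothesis-free).  For a
scale `X ≥ 5` take `k ≥ 1` minimal with `Q_k = 2^{a_k} ≥ X`: then `Q_{k−1} < X`, so
`log Q_k = a_{k−1}^4 log 2 < (log X)^4 / (log 2)^3 ≤ 4 (log X)^4`, and `|P_4 − s_k| ≤ 2·2^{−a_k^4} ≤ exp(−(log Q_k)^3)`. -/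
theorem coveredTower_ptower_four : CoveredTower (ptower 4) := by
  classical
  have hd : (2 : ℕ) ≤ 4 := by norm_num
  refine ⟨5, fun X hX => ?_⟩
  have hex : ∃ k, X ≤ 2 ^ pexp 4 k :=
    ⟨X, le_trans Nat.lt_two_pow_self.le
      (Nat.pow_le_pow_right (by norm_num) ((Nat.le_succ X).trans (succ_le_pexp hd X)))⟩
  obtain ⟨k, hk, hmin⟩ : ∃ k, X ≤ 2 ^ pexp 4 k ∧ ∀ j < k, ¬ X ≤ 2 ^ pexp 4 j :=
    ⟨Nat.find hex, Nat.find_spec hex, fun j hj => Nat.find_min hex hj⟩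
  obtain ⟨k', rfl⟩ : ∃ k', k = k' + 1 := by
    rcases k with _ | k'
    · have : X ≤ 4 := by simpa using hk
      omega
    · exact ⟨k', rfl⟩
  have hlt : 2 ^ pexp 4 k' < X := not_le.mp (hmin k' (Nat.lt_succ_self _))
  obtain ⟨r, hden, hlow, hup⟩ := ptower_truncation hd (k' + 1)
  refine ⟨r, by rw [hden]; exact hk, ?_, ?_⟩
  · -- the gap
    rw [hden, log_two_pow_nat, pexp_succ]
    push_cast
    have hA : (pexp 4 k' : ℝ) * Real.log 2 < Real.log X := by
      rw [← log_two_pow_nat]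
      exact Real.log_lt_log (by positivity) (by exact_mod_cast hlt)
    set u := (pexp 4 k' : ℝ) * Real.log 2 with hu
    have hu0 : 0 ≤ u := by positivity
    have h4 : u ^ 4 < Real.log X ^ 4 := pow_lt_pow_left₀ hA hu0 (by norm_num)
    obtain ⟨hl2, -⟩ := log_two_bounds
    have h069 : (0.69 : ℝ) ^ 3 ≤ Real.log 2 ^ 3 := pow_le_pow_left₀ (by norm_num) (by linarith) 3
    have hl3 : 1 ≤ 4 * Real.log 2 ^ 3 := by norm_num at h069 ⊢; linarith
    have hP0 : 0 ≤ (pexp 4 k' : ℝ) ^ 4 * Real.log 2 := by positivity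
    calc (pexp 4 k' : ℝ) ^ 4 * Real.log 2
          ≤ (pexp 4 k' : ℝ) ^ 4 * Real.log 2 * (4 * Real.log 2 ^ 3) := le_mul_of_one_le_right hP0 hl3
      _ = 4 * u ^ 4 := by rw [hu]; ring
      _ ≤ 4 * Real.log X ^ 4 := by linarith
  · -- the quality
    have hpos : 0 < ptower 4 - r := lt_of_lt_of_le (by positivity) hlow
    rw [abs_of_pos hpos, hden, log_two_pow_nat]
    refine le_trans hup (le_of_lt ?_)
    rw [pexp_succ 4 (k' + 1)]
    have h16 : 1 + 2 ≤ pexp 4 (k' + 1) :=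
      le_trans (by decide : 1 + 2 ≤ pexp 4 1) ((pexp_strictMono hd).monotone (by omega))
    have := trunc_quality (p := 3) (d := 4) (m := 1) (by norm_num) (by norm_num) h16
    simpa using this

/-- `a^d ≥ 2a + 2` for `a ≥ 4`, `d ≥ 2`. -/
private theorem two_mul_add_two_le_pow {a d : ℕ} (ha : 4 ≤ a) (hd : 2 ≤ d) : 2 * a + 2 ≤ a ^ d := by
  calc 2 * a + 2 ≤ a * a := by nlinarith
    _ = a ^ 2 := (sq a).symm
    _ ≤ a ^ d := Nat.pow_le_pow_right (by omega) hd

/-- **Effective irrationality measure of `P_d`** (`d ≥ 2`): for every rational `r` of denominator `q ≥ 4`,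
`|P_d − r| ≥ 1 / (2q · 2^{(log₂ q)^d})` — a QUASI-POLYNOMIAL measure `exp(−O((log q)^d))`.  Proof: with
`Q_j = 2^{a_j} ≤ q < Q_{j+1}`, the truncation `s_{j+1}` has denominator `Q_{j+1} ≠ q`, so
`|r − s_{j+1}| ≥ 1/(q Q_{j+1})`, while `|P_d − s_{j+1}| ≤ 2/2^{a_{j+1}^d} ≤ 1/(2 q Q_{j+1})`; and
`Q_{j+1} = 2^{a_j^d} ≤ 2^{(log₂ q)^d}`. -/
theorem ptower_sub_rat_lower {d : ℕ} (hd : 2 ≤ d) (r : ℚ) (hq : 4 ≤ r.den) :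
    1 / (2 * (r.den : ℝ) * (2 : ℝ) ^ (Nat.log 2 r.den ^ d)) ≤ |ptower d - r| := by
  classical
  set q : ℕ := r.den with hqdef
  have hq0R : (0 : ℝ) < q := by exact_mod_cast (show 0 < q by omega)
  -- `j` minimal with `q < Q_{j+1} = 2^{a_{j+1}}`; then `Q_j ≤ q`
  have hex : ∃ j : ℕ, q < 2 ^ pexp d (j + 1) :=
    ⟨q, lt_of_lt_of_le Nat.lt_two_pow_self
      (Nat.pow_le_pow_right (by norm_num) ((Nat.le_succ q).trans
        ((succ_le_pexp hd q).trans (pexp_lt_succ hd q).le)))⟩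
  set j : ℕ := Nat.find hex with hj
  have hjP : q < 2 ^ pexp d (j + 1) := Nat.find_spec hex
  have hjlow : 2 ^ pexp d j ≤ q := by
    rcases Nat.eq_zero_or_pos j with hj0 | hjpos
    · rw [hj0, pexp_zero]; norm_num; exact hq
    · have h := Nat.find_min hex (m := j - 1) (by omega)
      rw [Nat.sub_add_cancel hjpos] at h
      exact not_lt.mp h
  set Q : ℕ := 2 ^ pexp d (j + 1) with hQdef
  have ha4 : 4 ≤ pexp d (j + 1) := by
    rw [pexp_succ]
    have h2 := two_le_pexp (d := d) (by omega) j
    calc 4 = 2 ^ 2 := by norm_num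
      _ ≤ pexp d j ^ 2 := Nat.pow_le_pow_left h2 2
      _ ≤ pexp d j ^ d := Nat.pow_le_pow_right (by omega) hd
  have hQ0R : (0 : ℝ) < Q := by positivity
  have hqQ : q < Q := hjP
  -- the truncation `s = s_{j+1}` (denominator `Q`) and the tail `P_d − s`
  obtain ⟨s, hsden, hslow, hsup⟩ := ptower_truncation hd (j + 1)
  have hTpos : 0 < ptower d - s := lt_of_lt_of_le (by positivity) hslow
  -- `r ≠ s` (different denominators)
  have hrs : r ≠ s := by
    intro h; rw [h, hsden] at hqdef; omega
  -- `|r − s| ≥ 1/(qQ)`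
  have hsep : 1 / ((q : ℝ) * Q) ≤ |(r : ℝ) - s| := by
    have hne : r - s ≠ 0 := sub_ne_zero.mpr hrs
    have h1 : ((r - s : ℚ) : ℝ) = ((r - s).num : ℝ) / ((r - s).den : ℝ) := by
      exact_mod_cast ((r - s).num_div_den).symm
    have hnum : (1 : ℝ) ≤ |((r - s).num : ℝ)| := by
      have : (r - s).num ≠ 0 := Rat.num_ne_zero.mpr hne
      exact_mod_cast Int.one_le_abs this
    have hdendvd : (r - s).den ∣ q * Q := by
      rw [hqdef, hQdef, ← hsden]
      exact Rat.sub_den_dvd r s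
    have hdenle : ((r - s).den : ℝ) ≤ (q : ℝ) * Q := by
      have := Nat.le_of_dvd (by positivity) hdendvd
      exact_mod_cast this
    have hdenpos : (0 : ℝ) < (r - s).den := by exact_mod_cast (r - s).den_pos
    rw [show (r : ℝ) - s = ((r - s : ℚ) : ℝ) by push_cast; ring, h1, abs_div,
      abs_of_pos hdenpos]
    calc 1 / ((q : ℝ) * Q) ≤ 1 / ((r - s).den : ℝ) :=
          one_div_le_one_div_of_le hdenpos hdenle
      _ ≤ |((r - s).num : ℝ)| / ((r - s).den : ℝ) :=
          div_le_div_of_nonneg_right hnum hdenpos.le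
  -- the tail: `P_d − s ≤ 2/2^{a_{j+2}} ≤ 2/(4Q²) ≤ 1/(2 q Q)`
  have hTle : ptower d - s ≤ 1 / (2 * ((q : ℝ) * Q)) := by
    have h2 : 2 * pexp d (j + 1) + 2 ≤ pexp d (j + 2) := by
      rw [pexp_succ d (j + 1)]; exact two_mul_add_two_le_pow ha4 hd
    have h3 : (4 : ℝ) * (Q : ℝ) ^ 2 ≤ (2 : ℝ) ^ pexp d (j + 2) := by
      calc (4 : ℝ) * (Q : ℝ) ^ 2 = (2 : ℝ) ^ (2 * pexp d (j + 1) + 2) := by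
            rw [hQdef]; push_cast; ring
        _ ≤ (2 : ℝ) ^ pexp d (j + 2) := pow_le_pow_right₀ (by norm_num) h2
    have h5 : 2 * (1 / (2 : ℝ) ^ pexp d (j + 2)) ≤ 1 / (2 * ((q : ℝ) * Q)) := by
      rw [mul_one_div, div_le_div_iff₀ (by positivity) (by positivity)]
      have hqQR : (q : ℝ) ≤ Q := by exact_mod_cast hqQ.le
      nlinarith [hqQR, hQ0R, hq0R, h3]
    exact hsup.trans h5
  -- `|P_d − r| ≥ |r − s| − (P_d − s) ≥ 1/(2qQ)`
  have htri : |(r : ℝ) - s| - (ptower d - s) ≤ |ptower d - r| := by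
    have e : ptower d - r = (ptower d - s) - ((r : ℝ) - s) := by ring
    rw [e, abs_sub_comm (ptower d - s) ((r : ℝ) - s)]
    have h1 := abs_sub_abs_le_abs_sub ((r : ℝ) - s) (ptower d - s)
    rw [abs_of_pos hTpos] at h1
    exact h1
  -- `Q = 2^{a_j^d} ≤ 2^{(log₂ q)^d}`
  have hQle : (Q : ℝ) ≤ (2 : ℝ) ^ (Nat.log 2 q ^ d) := by
    have h1 : pexp d (j + 1) ≤ Nat.log 2 q ^ d := by
      rw [pexp_succ]
      exact Nat.pow_le_pow_left (Nat.le_log_of_pow_le (by norm_num) hjlow) d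
    have h2 : Q ≤ 2 ^ (Nat.log 2 q ^ d) := Nat.pow_le_pow_right (by norm_num) h1
    exact_mod_cast h2
  calc 1 / (2 * (q : ℝ) * (2 : ℝ) ^ (Nat.log 2 q ^ d)) ≤ 1 / (2 * ((q : ℝ) * Q)) := by
        rw [mul_assoc]
        apply one_div_le_one_div_of_le (by positivity)
        gcongr
    _ = 1 / ((q : ℝ) * Q) - 1 / (2 * ((q : ℝ) * Q)) := by field_simp; ring
    _ ≤ |(r : ℝ) - s| - (ptower d - s) := by linarith
    _ ≤ |ptower d - r| := htri

/-- Exponential beats polynomial, in the form used below: `b^d + b + 2 ≤ 2^b` for `b ≥ b₀(d)`. -/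
private theorem exists_pow_add_le_two_pow (d : ℕ) : ∃ b₀ : ℕ, ∀ b : ℕ, b₀ ≤ b → b ^ d + b + 2 ≤ 2 ^ b := by
  have ht := tendsto_pow_const_div_const_pow_of_one_lt d (by norm_num : (1 : ℝ) < 2)
  have hev : ∀ᶠ b : ℕ in atTop, (b : ℝ) ^ d / 2 ^ b < 1 / 4 := ht.eventually (gt_mem_nhds (by norm_num))
  obtain ⟨b₀, hb₀⟩ := Filter.eventually_atTop.mp hev
  refine ⟨max b₀ 1, fun b hb => ?_⟩
  have hb1 : 1 ≤ b := le_trans (le_max_right _ _) hb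
  have h := hb₀ b (le_trans (le_max_left _ _) hb)
  rw [div_lt_iff₀ (by positivity)] at h
  have hbR : (1 : ℝ) ≤ b := by exact_mod_cast hb1
  have hbd : (b : ℝ) ≤ (b : ℝ) ^ d ∨ d = 0 := by
    rcases Nat.eq_zero_or_pos d with h0 | hpos
    · exact Or.inr h0
    · exact Or.inl (le_self_pow₀ hbR (by omega))
  have key : ((b ^ d + b + 2 : ℕ) : ℝ) ≤ (2 : ℝ) ^ b := by
    push_cast
    rcases hbd with hle | h0
    · have h2 : (2 : ℝ) ≤ 2 * (b : ℝ) ^ d := by nlinarith [one_le_pow₀ (M₀ := ℝ) hbR (n := d)]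
      nlinarith
    · subst h0
      simp at h ⊢
      -- `1 + b + 2 ≤ 2^b` from `4 < 2^b`… and `b + 3 ≤ 2^b` for `2^b > 4`, i.e. `b ≥ 3`
      have hb3 : 3 ≤ b := by
        by_contra hlt
        interval_cases b <;> norm_num at h
      have : ((b + 3 : ℕ) : ℝ) ≤ (2 : ℝ) ^ b := by
        have hn : b + 3 ≤ 2 ^ b := by
          clear h hb hb₀ hev ht hbR hb1
          induction b, hb3 using Nat.le_induction with
          | base => norm_num
          | succ n hn ih => rw [pow_succ]; omega
        exact_mod_cast hn
      push_cast at this; linarith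
  exact_mod_cast key

/-- **`P_d` is NOT of exponential order `1`** (`d ≥ 2`) — in particular it is NOT Liouville-of-any-order /
hyper-Liouville: by the quasi-polynomial irrationality measure, `|P_d − r| ≥ 1/(2q·2^{(log₂ q)^d}) > e^{−q}`
for all large `q`. -/
theorem not_liouvilleOrder_one_ptower {d : ℕ} (hd : 2 ≤ d) : ¬ LiouvilleOrder 1 (ptower d) := by
  intro h
  obtain ⟨b₀, hb₀⟩ := exists_pow_add_le_two_pow d
  obtain ⟨r, hden, -, hlt⟩ := h (2 ^ b₀ + 4)
  set q : ℕ := r.den with hqdef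
  have hq4 : 4 ≤ q := le_trans (Nat.le_add_left 4 _) hden
  have hlow := ptower_sub_rat_lower hd r hq4
  set b : ℕ := Nat.log 2 q with hbdef
  have hb : b₀ ≤ b := by
    rw [hbdef, ← Nat.log_pow (b := 2) (by norm_num) b₀]
    exact Nat.log_mono_right (le_trans (Nat.le_add_right _ _) hden)
  have hqb : q < 2 ^ (b + 1) := Nat.lt_pow_succ_log_self (by norm_num) q
  have h2b : 2 ^ b ≤ q := Nat.pow_log_le_self 2 (by omega)
  -- `2 q 2^{b^d} < 2^{b+2} 2^{b^d} = 2^{b^d + b + 2} ≤ 2^{2^b} ≤ 2^q ≤ e^q`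
  have hkey : 2 * (q : ℝ) * (2 : ℝ) ^ (b ^ d) < Real.exp (q : ℝ) := by
    have h1 : 2 * (q : ℝ) * (2 : ℝ) ^ (b ^ d) < (2 : ℝ) ^ (b ^ d + b + 2) := by
      have : (q : ℝ) < (2 : ℝ) ^ (b + 1) := by exact_mod_cast hqb
      calc 2 * (q : ℝ) * (2 : ℝ) ^ (b ^ d) < 2 * (2 : ℝ) ^ (b + 1) * (2 : ℝ) ^ (b ^ d) := by
            gcongr
        _ = (2 : ℝ) ^ (b ^ d + b + 2) := by ring
    have h2 : (2 : ℝ) ^ (b ^ d + b + 2) ≤ (2 : ℝ) ^ q :=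
      pow_le_pow_right₀ (by norm_num) ((hb₀ b hb).trans h2b)
    have h3 : (2 : ℝ) ^ q ≤ Real.exp (q : ℝ) := by
      have h2e : (2 : ℝ) ≤ Real.exp 1 := by linarith [Real.add_one_le_exp (1 : ℝ)]
      calc (2 : ℝ) ^ q ≤ Real.exp 1 ^ q := pow_le_pow_left₀ (by norm_num) h2e _
        _ = Real.exp (q : ℝ) := by rw [← Real.exp_nat_mul, mul_one]
    linarith
  have hup : Real.exp (-((q : ℝ) ^ 1)) < 1 / (2 * (q : ℝ) * (2 : ℝ) ^ (b ^ d)) := by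
    rw [pow_one, Real.exp_neg, ← one_div]
    exact one_div_lt_one_div_of_lt (by positivity) hkey
  linarith

/-- Hence `P_d` is not hyper-Liouville and not Liouville of any exponential order `k ≥ 1`. -/
theorem not_hyperLiouville_ptower {d : ℕ} (hd : 2 ≤ d) : ¬ HyperLiouville (ptower d) :=
  fun h => not_liouvilleOrder_one_ptower hd (LiouvilleOrder.of_hyperLiouville h 1)

end Summit.Schanuel.Schanuel.Theorems.RootDecomp1ETwoScale
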